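import Summits.CriticalPhenomena.PercolationContinuityZ3.Theorems.PercNearOneGluingNoHeavyLowerTailSahiCombTriWCertGenTranslEmpty

/-!
# CERT-GEN(q): the PLAIN certificate (`q = 1`) has trivial kernel whenever `refl X ∩ Y ⊆ transl t Y` — a large family of the typed conjecture

Support file of the one-cut programme (crux `NoHeavyLowerTail`, stmt-CriticalPhenomena-4575; cell `prim-masterthm`, seat P5 gen 19;
memo `FROM-prim-masterthm-p5-g19-QZETA-CHANNELS.md` §8).  The proof of the no-flip case `certGenKernelAt_transl_empty` (`…TriWCertGenTranslEmpty`)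
uses `t = ∅` only through the inclusion of the `D₁`-set in the `E`-set, `refl X ∩ Y ⊆ refl X ∩ transl t Y`.  Under that inclusion alone the same
three steps work for ANY translate `t`:  lift `(A)` from `W` to `Y` (`zeta_sum_eq_zero_lift`), subtract `(E)` on `refl X ∩ Y ⊆ E` to isolate `a`
(`eq_zero_of_zeta_sum_eq_zero_of_support`), then C1 for `Y` and C2′.
CENSUS (this gen, code19/py/test31.py): the hypothesis holds on 1930/2888 configurations at `m = 3` and 1568/3000 sampled at `m = 4`, and on every one
of them the plain certificate is of full row rank (0 exceptions) — this theorem is the reason.  (In the cylinder case of `TiltCertIndep` the hypothesis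
is degenerate; for the general `CertGenKernel` it is about half of all configurations.)

* **`certGenKernelAt_one_of_refl_inter_subset`**: `refl X ∩ Y ⊆ refl X ∩ transl t Y → CertGenKernelAt X Y t 1`.
* `certGenKernel_exists_of_refl_inter_subset`: the `∃ q` form asked by `CertGenKernel`, on this family.
HONEST LABEL: proved (std axioms); outside the family (`refl X ∩ Y ⊄ transl t Y`) the plain certificate can fail and the conjecture stays OPEN. [this work]
-/

namespace Summit.CriticalPhenomena.PercolationContinuityZ3.Theorems

namespace FiveUpSet

open Finset

variable {α : Type} [DecidableEq α] [Fintype α]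

/-- **The plain certificate works whenever the `D₁`-set lies inside the `E`-set.**  For up-sets `X, Y` and a translate `t` with
`refl X ∩ Y ⊆ refl X ∩ transl t Y`, `CertGenKernelAt X Y t 1` holds: `(A)` at `q = 1` is a zeta relation for `a + c` (supported below `refl X`)
on `W`, which lifts to `Y`; on `refl X ∩ Y ⊆ E` the relation `(E)` removes the `c`-part, leaving a zeta relation for `a` on a family containing
`supp a`, so `a = 0`; then `c = 0` by C1 for `Y` and `b = 0` by C2′. [this work] -/
theorem certGenKernelAt_one_of_refl_inter_subset (X Y : Finset (Finset α)) (hX : IsUpperSet (X : Set (Finset α)))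
    (hY : IsUpperSet (Y : Set (Finset α))) (t : Finset α) (hsub : refl X ∩ Y ⊆ refl X ∩ transl t Y) :
    CertGenKernelAt X Y t 1 := by
  intro a b c ha hb hc hA hB hE
  have haX : ∀ d, a d ≠ 0 → dᶜ ∈ X := fun d hd => mem_refl.1 (mem_inter.1 (ha d hd)).1
  have hcX : ∀ d, c d ≠ 0 → dᶜ ∈ X := fun d hd => (mem_inter.1 (mem_refl.1 (hc d hd))).1
  have hcY : ∀ d, c d ≠ 0 → dᶜ ∈ Y := fun d hd => (mem_inter.1 (mem_refl.1 (hc d hd))).2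
  -- (A) at q = 1 for `a + c` on `W`, lifted to `Y`
  have hAW : ∀ u, u ∈ X ∩ Y → ∑ d, (a d + c d) * (if d ⊆ u then (1 : ℚ) else 0) = 0 := by
    intro u hu
    have h1 := hA u hu
    simp_rw [qzeta_one] at h1
    rw [← Finset.sum_add_distrib] at h1
    simpa only [add_mul] using h1
  have hAY := zeta_sum_eq_zero_lift X Y hX hY (fun d => a d + c d) (fun d hd => by
      by_cases h0 : a d = 0
      · rw [h0, zero_add] at hd; exact hcX d hd
      · exact haX d h0) hAW
  -- (E) on `refl X ∩ Y ⊆ E`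
  have hEY : ∀ u, u ∈ refl X ∩ Y → ∑ d, c d * (if d ⊆ u then (1 : ℚ) else 0) = 0 :=
    fun u hu => hE u (hsub hu)
  -- `a = 0`
  have ha0 : ∀ d, a d = 0 := by
    refine eq_zero_of_zeta_sum_eq_zero_of_support (refl X ∩ Y) a ha (fun u hu => ?_)
    have h1 := hAY u (mem_inter.1 hu).2
    have h2 := hEY u hu
    have h3 : ∑ d, (a d + c d) * (if d ⊆ u then (1 : ℚ) else 0)
        = ∑ d, a d * (if d ⊆ u then (1 : ℚ) else 0) + ∑ d, c d * (if d ⊆ u then (1 : ℚ) else 0) := by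
      rw [← Finset.sum_add_distrib]
      exact sum_congr rfl fun d _ => by ring
    rw [h3, h2, add_zero] at h1
    exact h1
  -- `c = 0` by C1 for `Y`
  have hc0 : ∀ d, c d = 0 := by
    refine eq_zero_of_zeta_sum_eq_zero hY c hcY (fun u hu => ?_)
    have h1 := hAY u hu
    have h3 : ∑ d, (a d + c d) * (if d ⊆ u then (1 : ℚ) else 0) = ∑ d, c d * (if d ⊆ u then (1 : ℚ) else 0) :=
      sum_congr rfl fun d _ => by rw [ha0 d, zero_add]
    rw [h3] at h1
    exact h1
  -- `b = 0` by C2′ for `(Y, X)`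
  have hb0 : ∀ d, b d = 0 := by
    refine eq_zero_of_zeta_sum_eq_zero_inter Y X hY hX b (fun d hd => ?_) (fun u hu => ?_)
    · have := mem_inter.1 (hb d hd)
      exact mem_inter.2 ⟨this.2, this.1⟩
    · have hu' : u ∈ X ∩ Y := by rw [inter_comm]; exact hu
      have h1 := hB u hu'
      have h2 : ∑ d, a d * qzeta 1 d u = 0 := Finset.sum_eq_zero fun d _ => by rw [ha0 d, zero_mul]
      rw [h2, zero_add] at h1
      exact h1
  exact ⟨ha0, hb0, hc0⟩

/-- The `∃ q` form asked by `CertGenKernel`, on the family `refl X ∩ Y ⊆ refl X ∩ transl t Y` (witness `q = 1`). [this work] -/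
theorem certGenKernel_exists_of_refl_inter_subset (X Y : Finset (Finset α)) (hX : IsUpperSet (X : Set (Finset α)))
    (hY : IsUpperSet (Y : Set (Finset α))) (t : Finset α) (hsub : refl X ∩ Y ⊆ refl X ∩ transl t Y) :
    ∃ q : ℚ, CertGenKernelAt X Y t q :=
  ⟨1, certGenKernelAt_one_of_refl_inter_subset X Y hX hY t hsub⟩

end FiveUpSet

end Summit.CriticalPhenomena.PercolationContinuityZ3.Theorems
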